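import Literature.NumberTheory.LFunctions.ZetaZeros
import Literature.NumberTheory.LFunctions.ZetaZerosProofs
import HarnessLib

/-!
# Reflection symmetry `m(1 - ρ) = m(ρ)` of the multiplicities of the zeros of `ζ`

Proof file (D-0014), sibling of `Literature/NumberTheory/LFunctions/ZetaZeros.lean` and
`ZetaZerosProofs.lean`. Discharge of the named fact `Literature.NumberTheory.LFunctions.riemannZetaZeroOrder_one_sub`
(`ZetaZeros.lean`; Titchmarsh §2.12): `m(1 - ρ) = m(ρ)` for `0 < Re ρ < 1`, where
`m = Literature.riemannZetaZeroOrder` is the meromorphic order of `ζ`.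

Proof: on the open strip the functional equation reads `ζ(1 - s) = Δ(s) ζ(s)` with
`Δ(s) = 2 (2π)^{-s} Γ(s) cos(πs/2)` (Mathlib `riemannZeta_one_sub`), where `Δ` is analytic and
non-zero (`Γ ≠ 0`; `cos(πs/2) = 0` only at odd integers), so the analytic orders of `s ↦ ζ(1 - s)`
and of `ζ` at `ρ` agree (`analyticOrderAt_mul`), and the former is the order of `ζ` at `1 - ρ`
(`analyticOrderAt_comp_one_sub`). Combined with the conjugation symmetry
`riemannZetaZeroOrder_conj_holds` (`ZetaZerosProofs.lean`) this gives `m(1 - ρ̄) = m(ρ)`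
(`riemannZetaZeroOrder_one_sub_conj`): the reflection `ρ ↦ 1 - ρ̄` in the critical line fixes
ordinates and multiplicities (used by `WeilZeroSum.lean` to transport zero-density bounds from the
right half of the critical strip to the left half).

(These declarations were accepted once as an append to `ZetaZerosProofs.lean`, p5717, and lost in
a subsequent whole-file update of that file; they are re-landed here in a file of their own.)

## References

* E. C. Titchmarsh, *The Theory of the Riemann Zeta-function*, 2nd ed. (rev. D. R. Heath-Brown),
  Oxford 1986, §2.12 (functional equation; symmetry of the zeros about `σ = 1/2` and the real axis).
-/

noncomputable section

open Complex Filter Topology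
open scoped ComplexConjugate Real

namespace Literature.NumberTheory.LFunctions

/-! ## Reflection symmetry of the multiplicities: discharge of `riemannZetaZeroOrder_one_sub` -/

/-- The order of vanishing of `s ↦ f (1 - s)` at `z₀` is that of `f` at `1 - z₀`. [folklore] -/
theorem analyticOrderAt_comp_one_sub {f : ℂ → ℂ} {z₀ : ℂ} (hf : AnalyticAt ℂ f (1 - z₀)) :
    analyticOrderAt (fun s ↦ f (1 - s)) z₀ = analyticOrderAt f (1 - z₀) := by
  have ht : Tendsto (fun s : ℂ ↦ 1 - s) (𝓝 z₀) (𝓝 (1 - z₀)) :=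
    (continuous_const.sub continuous_id).tendsto z₀
  have hlin : AnalyticAt ℂ (fun s : ℂ ↦ 1 - s) z₀ := analyticAt_const.sub analyticAt_id
  have hg : AnalyticAt ℂ (fun s ↦ f (1 - s)) z₀ := hf.comp_of_eq hlin rfl
  cases h : analyticOrderAt f (1 - z₀) with
  | top =>
    rw [analyticOrderAt_eq_top] at h ⊢
    exact ht.eventually h
  | coe n =>
    obtain ⟨g, hg_an, hg_ne, hg_eq⟩ := hf.analyticOrderAt_eq_natCast.mp h
    rw [hg.analyticOrderAt_eq_natCast]
    refine ⟨fun s ↦ (-1) ^ n * g (1 - s), analyticAt_const.mul (hg_an.comp_of_eq hlin rfl),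
      mul_ne_zero (pow_ne_zero _ (neg_ne_zero.2 one_ne_zero)) hg_ne, ?_⟩
    filter_upwards [ht.eventually hg_eq] with s hs
    rw [hs, smul_eq_mul, smul_eq_mul, show (1 - s - (1 - z₀)) = -(s - z₀) by ring, neg_pow]
    ring

/-- No point of the right half-plane `0 < Re s` is of the form `-n`, `n : ℕ`. [folklore] -/
theorem ne_neg_nat_of_re_pos {s : ℂ} (h₀ : 0 < s.re) (n : ℕ) : s ≠ -n := by
  intro hn
  have := congrArg Complex.re hn
  simp at this
  linarith [n.cast_nonneg (α := ℝ)]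

/-- The factor `Δ(s) = 2 (2π)^{-s} Γ(s) cos(πs/2)` of the functional equation
`ζ(1 - s) = Δ(s) ζ(s)` (Mathlib `riemannZeta_one_sub`) is analytic on `0 < Re s`.
[cite: Titchmarsh1986, §2.12] -/
theorem analyticAt_riemannZeta_feFactor {s : ℂ} (h₀ : 0 < s.re) :
    AnalyticAt ℂ (fun s ↦ 2 * (2 * π : ℂ) ^ (-s) * Gamma s * Complex.cos (π * s / 2)) s := by
  rw [analyticAt_iff_eventually_differentiableAt]
  filter_upwards [(isOpen_lt continuous_const continuous_re).mem_nhds h₀] with z hz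
  have h2π : (2 * π : ℂ) ≠ 0 := by exact_mod_cast (mul_pos two_pos Real.pi_pos).ne'
  refine ((DifferentiableAt.const_mul ?_ _).mul
    (Complex.differentiableAt_Gamma z (ne_neg_nat_of_re_pos hz))).mul ?_
  · exact differentiableAt_id.neg.const_cpow (Or.inl h2π)
  · exact (((differentiableAt_const _).mul differentiableAt_id).div_const _).ccos

/-- The factor `Δ(s) = 2 (2π)^{-s} Γ(s) cos(πs/2)` does not vanish on the open critical strip
`0 < Re s < 1` (`Γ(s) ≠ 0`; `cos(πs/2) = 0` iff `s` is an odd integer).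
[cite: Titchmarsh1986, §2.12] -/
theorem riemannZeta_feFactor_ne_zero {s : ℂ} (h₀ : 0 < s.re) (h₁ : s.re < 1) :
    2 * (2 * π : ℂ) ^ (-s) * Gamma s * Complex.cos (π * s / 2) ≠ 0 := by
  have h2π : (2 * π : ℂ) ≠ 0 := by exact_mod_cast (mul_pos two_pos Real.pi_pos).ne'
  refine mul_ne_zero (mul_ne_zero (mul_ne_zero two_ne_zero ?_)
    (Complex.Gamma_ne_zero (ne_neg_nat_of_re_pos h₀))) fun hcos ↦ ?_
  · rw [Ne, cpow_eq_zero_iff, not_and_or]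
    exact Or.inl h2π
  · obtain ⟨k, hk⟩ := Complex.cos_eq_zero_iff.1 hcos
    have hπ : (π : ℂ) ≠ 0 := ofReal_ne_zero.2 Real.pi_ne_zero
    have hk2 : (π : ℂ) * s = π * (2 * k + 1) := by linear_combination 2 * hk
    have hs : s = 2 * k + 1 := mul_left_cancel₀ hπ hk2
    have hre := congrArg Complex.re hs
    simp at hre
    rw [hre] at h₀ h₁
    have hk0 : (k : ℝ) < 0 := by linarith
    have hk1 : (-1 : ℝ) < k := by linarith
    have hk0' : k < 0 := by exact_mod_cast hk0
    have hk1' : -1 < k := by exact_mod_cast hk1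
    omega

/-- **Discharge of `Literature.NumberTheory.LFunctions.riemannZetaZeroOrder_one_sub`** (Titchmarsh §2.12): for `0 < Re ρ < 1`,
`m(1 - ρ) = m(ρ)`. On a neighbourhood of `ρ` in the open strip, `ζ(1 - s) = Δ(s) ζ(s)`
(`riemannZeta_one_sub`) with `Δ` analytic and `Δ(ρ) ≠ 0`, so
`ord_ρ ζ(1 - ·) = ord_ρ Δ + ord_ρ ζ = ord_ρ ζ`, while `ord_ρ ζ(1 - ·) = ord_{1-ρ} ζ`.
[cite: Titchmarsh1986, §2.12] -/
theorem riemannZetaZeroOrder_one_sub_holds : riemannZetaZeroOrder_one_sub := by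
  intro ρ h₀ h₁
  have hρ1 : ρ ≠ 1 := by
    rintro rfl
    simp at h₁
  have hρ1' : 1 - ρ ≠ 1 := by
    intro h
    have : ρ = 0 := by linear_combination -h
    rw [this] at h₀
    simp at h₀
  have hζ : AnalyticAt ℂ riemannZeta ρ := analyticOn_riemannZeta ρ hρ1
  have hζ' : AnalyticAt ℂ riemannZeta (1 - ρ) := analyticOn_riemannZeta _ hρ1'
  unfold riemannZetaZeroOrder
  rw [hζ.meromorphicOrderAt_eq, hζ'.meromorphicOrderAt_eq]
  congr 2
  rw [← analyticOrderAt_comp_one_sub hζ']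
  have hev : (fun s ↦ riemannZeta (1 - s)) =ᶠ[𝓝 ρ]
      (fun s ↦ 2 * (2 * π : ℂ) ^ (-s) * Gamma s * Complex.cos (π * s / 2)) * riemannZeta := by
    have hU : {s : ℂ | 0 < s.re} ∩ {s : ℂ | s.re < 1} ∈ 𝓝 ρ :=
      ((isOpen_lt continuous_const continuous_re).inter
        (isOpen_lt continuous_re continuous_const)).mem_nhds ⟨h₀, h₁⟩
    filter_upwards [hU] with s hs
    have hs1 : s ≠ 1 := by
      rintro rfl
      simp at hs
    simp only [Pi.mul_apply]
    exact riemannZeta_one_sub (ne_neg_nat_of_re_pos hs.1) hs1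
  rw [analyticOrderAt_congr hev, analyticOrderAt_mul (analyticAt_riemannZeta_feFactor h₀) hζ,
    (analyticAt_riemannZeta_feFactor h₀).analyticOrderAt_eq_zero.2
      (riemannZeta_feFactor_ne_zero h₀ h₁), zero_add]

/-- Symmetry of the multiplicities under `ρ ↦ 1 - ρ̄` in the open strip (composition of
`riemannZetaZeroOrder_one_sub_holds` and `riemannZetaZeroOrder_conj_holds`); this reflection fixes
ordinates. [cite: Titchmarsh1986, §2.12] -/
theorem riemannZetaZeroOrder_one_sub_conj {ρ : ℂ} (h₀ : 0 < ρ.re) (h₁ : ρ.re < 1) :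
    riemannZetaZeroOrder (1 - conj ρ) = riemannZetaZeroOrder ρ := by
  rw [show 1 - conj ρ = conj (1 - ρ) by simp, riemannZetaZeroOrder_conj_holds (1 - ρ)]
  exact riemannZetaZeroOrder_one_sub_holds h₀ h₁

end Literature.NumberTheory.LFunctions

end
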